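import Mathlib.Combinatorics.SetFamily.FourFunctions
import Mathlib.Order.UpperLower.Basic
import Mathlib.Tactic
import HarnessLib

/-!
# `NoHeavyLowerTail` (crux stmt-CriticalPhenomena-4575), master-family line P1 (gen 26):
# the JOIN/MEET-REFINED antipodal Harris count for two petals — in every sub-cube, the antipodal (C₁, C₂) pairs are at most the
# antipodal (cross-JOIN, cross-MEET) pairs (Daykin's inequality)

Support file (seat `prim-masterthm-p1`, gen 26; `--supports stmt-CriticalPhenomena-4575`).  Three definitions (`crossJoins`, `crossMeets`,
the two counted families are `abbrev`-free `def`s `crossPairs`, `payPairs`), no `sorry`, standard axioms.  Memo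
`run/shared/lean/prim/prim-masterthm/FROM-prim-masterthm-p1-g26-RAINBOW-JOINS.md` §0 (2-copy shadow).

SETTING.  Two families `U, V` of finite sets (the case of interest: two up-sets of `2^α`, a 2-petal sunflower with kernel `U ∩ V`, petals
`C₁ = U ∖ V`, `C₂ = V ∖ U`, outside `(U ∪ V)ᶜ`).  The CROSS JOINS are `J₂ = {x ∪ y : x ∈ C₁, y ∈ C₂}` and the CROSS MEETS `M₂ = {x ∩ y}`
(`crossJoins`, `crossMeets`; for up-sets `J₂ ⊆ U ∩ V` and `M₂ ⊆ (U ∪ V)ᶜ`, `crossJoins_subset_inter`, `crossMeets_disjoint`).  In the sub-cube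
`{B ∪ S : S ⊆ F}` the antipode of `B ∪ S` is `B ∪ (F ∖ S)`.

THEOREM (`card_crossPairs_le_card_payPairs`, this work): for ALL `B, F` and all `U, V` (no monotonicity needed),
  `#{S ⊆ F : B∪S ∈ C₁, B∪(F∖S) ∈ C₂} ≤ #{S ⊆ F : B∪S ∈ J₂, B∪(F∖S) ∈ M₂}`.
PROOF (five lines, Daykin): with `𝒜` the left family and `𝒜̄ = {F∖S : S ∈ 𝒜}`, every `S ∪ S'` (`S ∈ 𝒜`, `S' ∈ 𝒜̄`) lies in the right family
`𝒫` (its point is the join of a `C₁`- and a `C₂`-point, its antipode the meet of a `C₁`- and a `C₂`-point), and every `S ∩ S'` is the `F`-complement of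
a member of `𝒫`; Daykin's inequality `|𝒜|·|𝒜̄| ≤ |𝒜 ⊼ 𝒜̄|·|𝒜 ⊻ 𝒜̄|` (Mathlib `Finset.le_card_infs_mul_card_sups`) and `|𝒜̄| = |𝒜|` give `|𝒜|² ≤ |Py|²`.
This is the two-petal case of the gen-26 conjecture G_JM ("refined antipodal Gladkov": paying (kernel, outside) pairs restricted to (cross joins,
cross meets)), census-exact for three petals on all of `2^≤5` (memo §0, §2); the unrefined count `#(C₁,C₂) ≤ #(K,O)` is prove-1's
`Sunflower.card_distinctPetals_le` (two petals).  Summed with product weights it is the 2-copy (tensor–Bernstein) form of the Ahlswede–Daykin bound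
`μ(C₁)μ(C₂) ≤ μ(J₂)μ(M₂)`. [this work]
-/

namespace Summit.CriticalPhenomena.PercolationContinuityZ3.Theorems.SahiRainbowJoins

open Finset
open scoped FinsetFamily

variable {α : Type*} [DecidableEq α]

/-- Cross joins `{x ∪ y : x ∈ U ∖ V, y ∈ V ∖ U}`. [this work] -/
def crossJoins (U V : Finset (Finset α)) : Finset (Finset α) :=
  ((U \ V) ×ˢ (V \ U)).image fun p => p.1 ∪ p.2

/-- Cross meets `{x ∩ y : x ∈ U ∖ V, y ∈ V ∖ U}`. [this work] -/
def crossMeets (U V : Finset (Finset α)) : Finset (Finset α) :=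
  ((U \ V) ×ˢ (V \ U)).image fun p => p.1 ∩ p.2

/-- The antipodal CROSS pairs of the sub-cube `{B ∪ S : S ⊆ F}`, indexed by the `C₁`-side `S`: `B ∪ S ∈ U ∖ V` and `B ∪ (F ∖ S) ∈ V ∖ U`.
[this work] -/
def crossPairs (U V : Finset (Finset α)) (B F : Finset α) : Finset (Finset α) :=
  F.powerset.filter fun S => B ∪ S ∈ U \ V ∧ B ∪ (F \ S) ∈ V \ U

/-- The antipodal (cross-JOIN, cross-MEET) pairs of the sub-cube: `B ∪ S ∈ J₂` and `B ∪ (F ∖ S) ∈ M₂`. [this work] -/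
def payPairs (U V : Finset (Finset α)) (B F : Finset α) : Finset (Finset α) :=
  F.powerset.filter fun S => B ∪ S ∈ crossJoins U V ∧ B ∪ (F \ S) ∈ crossMeets U V

/-- Membership in the cross joins. [this work] -/
theorem mem_crossJoins {U V : Finset (Finset α)} {x y : Finset α} (hx : x ∈ U \ V) (hy : y ∈ V \ U) :
    x ∪ y ∈ crossJoins U V :=
  mem_image.2 ⟨(x, y), mem_product.2 ⟨hx, hy⟩, rfl⟩

/-- Membership in the cross meets. [this work] -/
theorem mem_crossMeets {U V : Finset (Finset α)} {x y : Finset α} (hx : x ∈ U \ V) (hy : y ∈ V \ U) :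
    x ∩ y ∈ crossMeets U V :=
  mem_image.2 ⟨(x, y), mem_product.2 ⟨hx, hy⟩, rfl⟩

/-- For up-sets the cross joins lie in the kernel `U ∩ V`. [this work] -/
theorem crossJoins_subset_inter {U V : Finset (Finset α)} (hU : IsUpperSet (U : Set (Finset α)))
    (hV : IsUpperSet (V : Set (Finset α))) : crossJoins U V ⊆ U ∩ V := by
  intro z hz
  obtain ⟨⟨x, y⟩, hxy, rfl⟩ := mem_image.1 hz
  obtain ⟨hx, hy⟩ := mem_product.1 hxy
  exact mem_inter.2 ⟨hU (show x ≤ x ∪ y from subset_union_left) (mem_sdiff.1 hx).1,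
    hV (show y ≤ x ∪ y from subset_union_right) (mem_sdiff.1 hy).1⟩

/-- For up-sets the cross meets lie outside `U ∪ V`. [this work] -/
theorem crossMeets_disjoint {U V : Finset (Finset α)} (hU : IsUpperSet (U : Set (Finset α)))
    (hV : IsUpperSet (V : Set (Finset α))) {z : Finset α} (hz : z ∈ crossMeets U V) : z ∉ U ∪ V := by
  obtain ⟨⟨x, y⟩, hxy, rfl⟩ := mem_image.1 hz
  obtain ⟨hx, hy⟩ := mem_product.1 hxy
  intro h
  rcases mem_union.1 h with h | h
  · exact (mem_sdiff.1 hy).2 (hU (show x ∩ y ≤ y from inter_subset_right) h)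
  · exact (mem_sdiff.1 hx).2 (hV (show x ∩ y ≤ x from inter_subset_left) h)

/-- Set algebra in the sub-cube: `(B ∪ S) ∪ (B ∪ T) = B ∪ (S ∪ T)`. [folklore] -/
private theorem union_union_eq (B S T : Finset α) : (B ∪ S) ∪ (B ∪ T) = B ∪ (S ∪ T) := by
  ext a; simp only [mem_union]; tauto

/-- Set algebra in the sub-cube: `(B ∪ S) ∩ (B ∪ T) = B ∪ (S ∩ T)`. [folklore] -/
private theorem union_inter_eq (B S T : Finset α) : (B ∪ S) ∩ (B ∪ T) = B ∪ (S ∩ T) := by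
  ext a; simp only [mem_union, mem_inter]; tauto

/-- For `S' ⊆ F`: `F ∖ (S ∪ (F ∖ S')) = (F ∖ S) ∩ S'`. [folklore] -/
private theorem sdiff_union_sdiff_eq {F S S' : Finset α} (hS' : S' ⊆ F) : F \ (S ∪ (F \ S')) = (F \ S) ∩ S' := by
  ext a
  have haF : a ∈ S' → a ∈ F := fun h => hS' h
  simp only [mem_sdiff, mem_union, mem_inter]
  tauto

/-- For `S ⊆ F`: `F ∖ ((F ∖ S) ∪ S') = S ∩ (F ∖ S')`. [folklore] -/
private theorem sdiff_sdiff_union_eq {F S S' : Finset α} (hS : S ⊆ F) : F \ ((F \ S) ∪ S') = S ∩ (F \ S') := by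
  ext a
  have haF : a ∈ S → a ∈ F := fun h => hS h
  simp only [mem_sdiff, mem_union, mem_inter]
  tauto

/-- **Refined antipodal Harris count (two petals; Daykin).**  In every sub-cube `{B ∪ S : S ⊆ F}` the number of antipodal pairs labelled
`(U∖V, V∖U)` is at most the number of antipodal pairs labelled (cross join, cross meet). [this work] -/
theorem card_crossPairs_le_card_payPairs (U V : Finset (Finset α)) (B F : Finset α) :
    #(crossPairs U V B F) ≤ #(payPairs U V B F) := by
  set 𝒜 := crossPairs U V B F with h𝒜
  set Py := payPairs U V B F with hPy
  set cpl : Finset α → Finset α := fun S => F \ S with hcpl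
  set 𝒜' := 𝒜.image cpl with h𝒜'
  -- membership unpacking
  have memA : ∀ {S}, S ∈ 𝒜 → S ⊆ F ∧ B ∪ S ∈ U \ V ∧ B ∪ (F \ S) ∈ V \ U := fun {S} hS => by
    have h := mem_filter.1 hS
    exact ⟨mem_powerset.1 h.1, h.2.1, h.2.2⟩
  have memP : ∀ {T}, T ⊆ F → B ∪ T ∈ crossJoins U V → B ∪ (F \ T) ∈ crossMeets U V → T ∈ Py :=
    fun {T} hT h1 h2 => mem_filter.2 ⟨mem_powerset.2 hT, h1, h2⟩
  -- (1) sups land in Py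
  have hsup : 𝒜 ⊻ 𝒜' ⊆ Py := by
    intro T hT
    obtain ⟨S, hS, T', hT', rfl⟩ := mem_sups.1 hT
    obtain ⟨S', hS', rfl⟩ := mem_image.1 hT'
    obtain ⟨hSF, hS1, hS2⟩ := memA hS
    obtain ⟨hS'F, hS'1, hS'2⟩ := memA hS'
    refine memP (union_subset hSF sdiff_subset) ?_ ?_
    · -- B ∪ (S ∪ (F \ S')) = (B ∪ S) ∪ (B ∪ (F \ S'))
      rw [show S ⊔ cpl S' = S ∪ (F \ S') from rfl, ← union_union_eq]
      exact mem_crossJoins hS1 hS'2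
    · rw [show S ⊔ cpl S' = S ∪ (F \ S') from rfl, sdiff_union_sdiff_eq hS'F, inter_comm, ← union_inter_eq]
      exact mem_crossMeets hS'1 hS2
  -- (2) infs land in the complement image of Py
  have hinf : 𝒜 ⊼ 𝒜' ⊆ Py.image cpl := by
    intro T hT
    obtain ⟨S, hS, T', hT', rfl⟩ := mem_infs.1 hT
    obtain ⟨S', hS', rfl⟩ := mem_image.1 hT'
    obtain ⟨hSF, _, _⟩ := memA hS
    have hmem : (F \ S) ∪ S' ∈ Py := by
      have : cpl S ⊔ S' ∈ 𝒜' ⊻ 𝒜 := mem_sups.2 ⟨cpl S, mem_image.2 ⟨S, hS, rfl⟩, S', hS', rfl⟩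
      rw [sups_comm] at this
      exact hsup this
    refine mem_image.2 ⟨(F \ S) ∪ S', hmem, ?_⟩
    show F \ ((F \ S) ∪ S') = S ⊓ cpl S'
    rw [sdiff_sdiff_union_eq hSF]
    rfl
  -- (3) cardinalities
  have hcplinj : Set.InjOn cpl ↑𝒜 := by
    intro S hS S' hS' h
    have hSF := (memA (mem_coe.1 hS)).1
    have hS'F := (memA (mem_coe.1 hS')).1
    have : F \ (F \ S) = F \ (F \ S') := by rw [show F \ S = cpl S from rfl, h]
    rwa [Finset.sdiff_sdiff_eq_self hSF, Finset.sdiff_sdiff_eq_self hS'F] at this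
  have hcardA' : #𝒜' = #𝒜 := card_image_of_injOn hcplinj
  have hday := Finset.le_card_infs_mul_card_sups 𝒜 𝒜'
  have h1 : #(𝒜 ⊻ 𝒜') ≤ #Py := card_le_card hsup
  have h2 : #(𝒜 ⊼ 𝒜') ≤ #Py := (card_le_card hinf).trans card_image_le
  have hsq : #𝒜 * #𝒜 ≤ #Py * #Py := by
    calc #𝒜 * #𝒜 = #𝒜 * #𝒜' := by rw [hcardA']
      _ ≤ #(𝒜 ⊼ 𝒜') * #(𝒜 ⊻ 𝒜') := hday
      _ ≤ #Py * #Py := Nat.mul_le_mul h2 h1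
  exact Nat.mul_self_le_mul_self_iff.1 hsq

end Summit.CriticalPhenomena.PercolationContinuityZ3.Theorems.SahiRainbowJoins
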